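import Summits.AtomisticToContinuum.BoseEinsteinCondensation.Theorems.BECGroundStateSOSPeriodicIRBoundTwoSectorPairDefs
import HarnessLib

/-!
# Route `BECGroundStateSOS`, crux `PeriodicIRBound` (stmt-AtomisticToContinuum-3972), line `two-sector-gd-transfer` —
# v11 Defs, part 2: the soft-location assembly split into an analytic fixed-`(N, L)` stub and a filter stub

Sequel of `…TwoSectorPairDefs.lean` (p162131, lead c23). The assembly stub S11d₂ `SoftLocationOf` is sized for two
workers: S11d₂ₐ `EffectiveGapAt` (fixed `(N, L)`, one mode: the exchange bound S11a, the cosine bound S11e, the two-sided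
f-sum S11b, Born's chemical-potential bound and the variational bounds of the two test vectors combine, at every
near-minimiser with condensate fraction `θ`, into the EFFECTIVE GAP
`𝓔[aψ] + 𝓔[a†ψ] − E₀(2n_k+1) − (E₀(N) − E₀(N−1)) ≥ ‖p‖² + (7θ/4 − 1)·N‖v‖₁/L³ − η`) and S11d₂ᵦ `SoftLocationOfGap`
(filters and window arithmetic: X(v), the condensate fraction S11c at `θ = 7/8`, the real-algebra core S11d₁). Glue:
`softLocationOf_of_split`. Statements of a proof plan, not results in print (`Cruxes/PeriodicIRBound/SOFT-LOCATION.md`).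
-/

noncomputable section

open scoped BigOperators ENNReal ComplexConjugate
open Filter MeasureTheory

namespace Summit.AtomisticToContinuum.BoseEinsteinCondensation.Cruxes.PeriodicIRBound.TwoSectorGdTransfer

open Literature.MathematicalPhysics.QuantumManyBody.BoseGas
open Summit.AtomisticToContinuum.BoseEinsteinCondensation.Theorems.PeriodicIRBound.Negative (IRBoundFor)
open Summit.AtomisticToContinuum.BoseEinsteinCondensation.Cruxes.PeriodicIRBound.LinearPhFloorWagner
  (WF.qform WF.normSq WF.IsCore WF.exchCoef WF.wL1)

/-- **Stub S11d₂ₐ statement — the effective gap at fixed `(N, L) = (m+2, L)` and one mode `n ≠ 0`** (analytic, per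
state). For an integrable admissible `v` of range `R`, a mode with `‖p‖R ≤ 1/4` (`p = 2πn/L`), a condensate fraction
`θ ≥ 0` and `η > 0`: there is `δ > 0` such that every momentum-zero `δ`-near-minimiser `Ψ` with `n₀(Ψ) ≥ θN` obeys, with
`e0 = E₀(N)`, `e0m = E₀(N−1)`, `e0p = E₀(N+1)` (all finite for integrable `v`),
`‖p‖² + (7θ/4 − 1)·N‖v‖₁/L³ − η ≤ 𝓔[aψ] + 𝓔[a†ψ] − e0(2n_k+1) − (e0 − e0m)` together with the variational bounds
`e0m·n_k ≤ 𝓔[aψ]`, `e0p(n_k+1) ≤ 𝓔[a†ψ]`, `e0 ≤ e0p`. Plan: S11b (`FsumLowerBound`, at `η`) + S11a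
(`ExchangeCondensateBound` at `Φ := Ψ.ψ`, `‖Ψ‖ = 1`) + S11e (`PotCosLowerBound`: `v̂_L(p) ≥ (3/4)‖v‖₁`) give
`≥ ‖p‖² + N‖v‖₁/L³ + [(3/4)‖v‖₁·n₀ − ‖v‖₁(N − n₀)]/L³ − η`; Born (`PuffFloorRemovalEnergy.periodicGroundStateEnergy_succ_le`:
`E₀(m+2) ≤ E₀(m+1) + (m+1)(ofReal L³)⁻¹∫v`) gives `e0 − e0m ≤ (N−1)‖v‖₁/L³`; with `n₀ ≥ θN` the bracket is
`≥ (7θ/4 − 1)N‖v‖₁`. The variational bounds: `aψ`, `a†ψ` have momentum `∓p` (`WF.hasTotalMomentum_modeAn/_modeCr`), so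
`E₀(m+1)‖aψ‖² ≤ E_{−p}(m+1)‖aψ‖² ≤ 𝓔[aψ]` (`periodicGroundStateEnergy_le_momentumSectorEnergy`,
`WF.momentumSectorEnergy_mul_normSq_le`, `WF.normSq_modeAn`) and likewise at `m+3` (`WF.normSq_modeCr`), `E₀(m+2) ≤ E₀(m+3)`
(`WF.periodicGroundStateEnergy_le_succ`). Provable now. -/
def EffectiveGapAt : Prop :=
  ∀ v : ℝ → ℝ≥0∞, IsRepulsiveFiniteRange v → (∫⁻ x : Space, v ‖x‖) ≠ ⊤ →
    ∀ R : ℝ, 0 < R → (∀ r : ℝ, R < r → v r = 0) →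
    ∀ (m : ℕ) (L : ℝ), 0 < L → ∀ n : Fin 3 → ℤ, n ≠ 0 → ‖latticeVec (2 * Real.pi / L) n‖ * R ≤ 1 / 4 →
      ∀ θ η : ℝ, 0 ≤ θ → 0 < η → ∃ δ : ℝ≥0∞, 0 < δ ∧ ∀ Ψ : PeriodicTrialState (m + 2) L, NearMinAt v δ Ψ →
        HasTotalMomentum 0 Ψ.ψ → θ * ((m : ℝ) + 2) ≤ (cellOccupation (m + 2) L (planeWaveMode L 0) Ψ.ψ).toReal →
          let e0 : ℝ := (periodicGroundStateEnergy v (m + 2) L).toReal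
          let e0m : ℝ := (periodicGroundStateEnergy v (m + 1) L).toReal
          let e0p : ℝ := (periodicGroundStateEnergy v (m + 2 + 1) L).toReal
          let nk : ℝ := (cellOccupation (m + 2) L (planeWaveMode L n) Ψ.ψ).toReal
          let qC : ℝ := (WF.qform v L (modeCr (planeWaveMode L n) Ψ.ψ)).toReal
          let qA : ℝ := (WF.qform v L (modeAn L (planeWaveMode L n) Ψ.ψ)).toReal
          ‖latticeVec (2 * Real.pi / L) n‖ ^ 2 + (7 * θ / 4 - 1) * (((m : ℝ) + 2) * WF.wL1 v / L ^ 3) - η ≤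
              qA + qC - e0 * (2 * nk + 1) - (e0 - e0m) ∧
            e0m * nk ≤ qA ∧ e0p * (nk + 1) ≤ qC ∧ e0 ≤ e0p

/-- **Stub S11d₂ₐ (arrow form, registered)**: S11a → S11e → S11b → `EffectiveGapAt`. -/
def EffectiveGapOf : Prop :=
  ExchangeCondensateBound → PotCosLowerBound → FsumLowerBound → EffectiveGapAt

/-- **Stub S11d₂ᵦ statement — the soft-location arrow from the effective gap** (filters and window arithmetic only).
Plan (template: `…TwoSectorLinearFloorArrow.lean`, p160612): fix `K > 0`, `κ := K/(2π)`; X(v) at `κ` gives `ρX, C_X` and,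
eventually in `N`, a slack `δ_X` with `n_k ≤ Bm := C_X√ρL/‖n‖_∞` on the low window; S11c gives `ρB` and a slack `δ_B` with
`n₀ ≥ (7/8)N`; the range `R` of `v` (`exists_pos_range`) and `ρR := (1/(4√3KR))²` give `‖p‖R ≤ √3K√ρR ≤ 1/4`; the effective
gap at `θ = 7/8`, `η := ρ‖v‖₁/32` gives `G := ‖p‖² + (17/32 − 1/32)ρ‖v‖₁ = ‖p‖² + ρ‖v‖₁/2` below
`qA + qC − e0(2nk+1) − (e0 − e0m)`; constants `C := 1/π² + 16C_X²/‖v‖₁` (`‖v‖₁ > 0` from `∫v ≠ 0`), `b := CL²/‖n‖²_∞`,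
`A := κ(C_X+κ)/C` (`FloorArrow.B_add_one_div_le`: `(Bm+1)/b ≤ Aρ`), and the numeric gap
`(Bm+1)(2Bm+1) ≤ 4C_X²ρL²/‖n‖² + 4 ≤ b·G` (`‖p‖² ≥ 4π²‖n‖²_∞/L²`); S11d₁ `PairSharesReal` per state with
`Fl := G + (e0 − e0m)` then yields `ChanPairZero v m L n b (Aρ) e` with `μ₊ = μ₋`; least slack `min δ_X (min δ_B δ_G)`.
Provable now. -/
def SoftLocationOfGap : Prop :=
  EffectiveGapAt → CondensateFractionOfIR → PairSharesReal → SoftLocation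

/-- **Glue**: the two halves give S11d₂ `SoftLocationOf`. [folklore] -/
theorem softLocationOf_of_split (ha : EffectiveGapOf) (hb : SoftLocationOfGap) : SoftLocationOf :=
  fun h11a h11e h11b h11c h11d₁ => hb (ha h11a h11e h11b) h11c h11d₁

/-- **Registered by-product `stub_softLocationOfSplit` of the crux ledger** (v11): the split of S11d₂. [folklore] -/
theorem stub_softLocationOfSplit : EffectiveGapOf → SoftLocationOfGap → SoftLocationOf :=
  softLocationOf_of_split

end Summit.AtomisticToContinuum.BoseEinsteinCondensation.Cruxes.PeriodicIRBound.TwoSectorGdTransfer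

end
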